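import Summits.NavierStokesRegularity.FluidComputer.PalasekTowerLundgrenChildCeilingNumeric
import Summits.NavierStokesRegularity.FluidComputer.PalasekTowerLundgrenChildSwirlFloor
import Summits.NavierStokesRegularity.FluidComputer.PalasekTowerBurgersNumber

/-!
# REGISTER v2.3″ (continued): the any-profile WINDOW BAND of a Lundgren-carried child core in register
# units — early sharp stretch ceiling, strain floor after the budget, and the «Burgers number» thresholds
# of the numeric any-profile ceiling against the velocity floor

Cell `ns-blowup`, seat `ns-blowup-ecbridge-8` (g8); evidence toward crux 19250 `HeredityFromTwo` (UPPER
half `stub_window_ceiling` and floors `stub_speed_floors` / `stub_strain_floors`) of route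
`PalasekTowerBreakdown`, in the MODEL lane and with the MODEL IDENTIFICATION of
`PalasekTowerLundgrenChildLaws` («child core = cross-section of Lundgren's stretched flow in the host
strain `c = λA_k` at `ν = 1`», co-signed axial vorticity, cross-section circulation `Γ`). Four readings:

* `palasekTowerBreakdown_childSwirl_le_sqrtStretch_anyProfile_sharp` — EARLY window: with the initial
  peak bound `ω_z(0, ·) ≤ B`, **`‖swirl(t, y)‖ ≤ e^{λA_k t/2} (BΓ/4π)^{1/2}`** (the sharp kinematic
  constant of `BiotSavart2DSharpSupBound`; the g5 bound `_childSwirl_le_sqrtStretch_anyProfile` was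
  `e^{λA_k t/2}·2(BΓ/2π)^{1/2}`, i.e. `2√2` times larger);
* `palasekTowerBreakdown_childStrain_floor_of_budget_anyProfile` — STRAIN FLOOR: once the N-2′
  compaction budget is delivered, every pointwise bound `‖∇u(t, ·)‖ ≤ L` of the FULL velocity gradient
  of the child's flow has **`L ≥ Γ·λA_k/(16πρ)`** — one half of the peak floor `ΓλA_k/(8πρ)`
  (`_childPeak_floor_of_budget_anyProfile`), because `|ω_z| ≤ 2‖∇u‖` pointwise (MB (1.11)); the
  Burgers vortex has swirl-gradient norm exactly `ΓλA_k/(8π)` on its axis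
  (`norm_fderiv_burgersVortexSwirl_axis`);
* `palasekTowerBreakdown_anyProfile_noOvershoot_late` — the numeric late ceiling
  (`_childSwirl_le_after_one_strain_time_anyProfile_sharp`, `S ≤ 0.3556·Γ(λA_k)^{1/2}`) in the
  «Burgers number» units of `PalasekTowerBurgersNumber` (`Γ ≤ C·N_{k+1}^{β−2}`,
  `P := C√λ·N_k^{β/2−b}`): **`0.3556·P ≤ c₂` ⇒ no overshoot of `c₂Y_{k+1}` after one strain time,
  for ANY co-signed profile** (the Burgers child needed only `P ≤ 4√2π·c₂ = 17.77·c₂`,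
  `_burgers_noOvershoot`);
* `palasekTowerBreakdown_anyProfile_floor_threshold` — the any-profile swirl FLOOR after the budget
  (`_childSwirl_floor_of_budget_anyProfile`, `S ≥ (8π)⁻¹ρ^{−1/2}·Γ(λA_k)^{1/2}`) in the same units
  (`Γ ≥ C·N_{k+1}^{β−2}`): **`P ≥ 8π ρ^{1/2} c₁` ⇒ the velocity floor `c₁Y_{k+1}` is met**; and the
  certified arithmetic `palasekTowerBreakdown_anyProfile_thresholds_disjoint`: under `Schedule.Rigid`
  (`c₁ = 1`, `c₂ = 5/3`) the ceiling-certified region `P ≤ c₂/0.3556 < 4.69` and the floor-certified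
  region `P ≥ 8πρ^{1/2} > 25.13` are DISJOINT for every `ρ ≥ 1` — the any-profile bounds alone never
  exhibit a child meeting the floor without risking the ceiling (the RADIAL class does:
  `PalasekTowerRadialChildRelaxation`, certified band `P ∈ [20.5, 26.6]` at `ε = 1/50`; Burgers
  `[19.9, 29.6]`, `PalasekTowerBurgersNumber`).

WHAT THIS IS NOT: not NS about any registered flow — exact INFINITE-ENERGY Lundgren flows, no registered
stage; nothing is asserted about `AprioriCeiling`, `WindowCeilingAt`, `ReadoutFloors` or any crux; the
identification «child core = Lundgren cross-section» is a MODEL step, and the disjointness is a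
statement about BOUNDS (the extremal profiles of the kinematic ceiling — Rankine — and of the floor differ),
not about any flow.

References: P. G. Saffman, *Vortex Dynamics*, CUP 1992, §13.3 (26)–(31) [cite: Saffman1992, §13.3
eqs. (26)–(31)]; A. J. Majda, A. L. Bertozzi, CUP 2002, §1.1 (1.11), §8.2.3 (8.27)
[cite: MajdaBertozziCUP2002, §1.1 eq. (1.11)]; D. Iftimie, T. C. Sideris, P. Gamblin, Comm. PDE 24 (1999),
Lemma 2.1 [cite: IftimieSiderisGamblin1999, Lemma 2.1]; S. Palasek, arXiv:2605.13827, §3 (3.2)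
[cite: Palasek2026ElementaryModel, §3 (3.2)].
-/

namespace Summit.NavierStokesRegularity.FluidComputer.PalasekTowerClayBridge

open Real Set MeasureTheory
open Literature.Analysis.FluidPDE Literature.Analysis.FluidPDE.Lundgren

variable {S S' : Set ℝ}
  {v : ℝ → EuclideanSpace ℝ (Fin 2) → EuclideanSpace ℝ (Fin 2)}
  {q : ℝ → EuclideanSpace ℝ (Fin 2) → ℝ} {w : ℝ → EuclideanSpace ℝ (Fin 2) → ℝ}

/-! ### §1 Early window: the sharp stretch ceiling -/

/-- **EARLY WINDOW, SHARP KINEMATIC CONSTANT** (`ν = 1`, host strain `λA_k`; setting of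
`_childSwirl_le_sqrtStretch_anyProfile`): for a co-signed child with `ω_z(0, ·) ≤ B` and cross-section
circulation `Γ`, at every `t ≥ 0` of `S` and every `y`,
**`‖e^{ct/2} ṽ(T(t), e^{ct/2} y)‖ ≤ e^{ct/2} · (BΓ/4π)^{1/2}`** (`c = λA_k`) —
`Lundgren.norm_swirl_lundgren_le_sqrt_sharp` at `ν = 1`, `t₀ = 0`; `2√2` times below the g5 bound. -/
theorem palasekTowerBreakdown_childSwirl_le_sqrtStretch_anyProfile_sharp (R : TowerRates) (k : ℕ)
    {l : ℝ} (hl : 0 < l) (hS' : Convex ℝ S') (hv : IsClassicalNSSolutionOn S' 1 0 v q)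
    (hω : HasUniformRapidDecayOn S' (fun σ η => PlanarEigenmode.vorticity (v σ) η))
    (hBS : ∀ σ ∈ S', ∀ η, v σ η = biotSavart2D (PlanarEigenmode.vorticity (v σ)) η)
    (hw : IsSmoothSpaceTimeOn S' w)
    (hmaps : MapsTo (fun t => (exp (l * R.A k * t) - 1) / (l * R.A k)) S S') (h0 : (0 : ℝ) ∈ S)
    {t : ℝ} (ht : t ∈ S) (htt : 0 ≤ t)
    (hpos : ∀ x : EuclideanSpace ℝ (Fin 3), 0 ≤ curl (velocity (fun _ => l * R.A k)
          (fun t y => exp (l * R.A k * t / 2) •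
            v ((exp (l * R.A k * t) - 1) / (l * R.A k)) (exp (l * R.A k * t / 2) • y))
          (fun t y => exp (-(l * R.A k * t)) •
            w ((exp (l * R.A k * t) - 1) / (l * R.A k)) (exp (l * R.A k * t / 2) • y)) 0) x 2)
    {B : ℝ} (hB : ∀ x : EuclideanSpace ℝ (Fin 3), curl (velocity (fun _ => l * R.A k)
          (fun t y => exp (l * R.A k * t / 2) •
            v ((exp (l * R.A k * t) - 1) / (l * R.A k)) (exp (l * R.A k * t / 2) • y))
          (fun t y => exp (-(l * R.A k * t)) •
            w ((exp (l * R.A k * t) - 1) / (l * R.A k)) (exp (l * R.A k * t / 2) • y)) 0) x 2 ≤ B)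
    (z₀ : ℝ) (y : EuclideanSpace ℝ (Fin 2)) :
    ‖exp (l * R.A k * t / 2) •
        v ((exp (l * R.A k * t) - 1) / (l * R.A k)) (exp (l * R.A k * t / 2) • y)‖ ≤
      exp (l * R.A k * t / 2) * Real.sqrt (B *
        (∫ y' : EuclideanSpace ℝ (Fin 2),
          curl (velocity (fun _ => l * R.A k)
            (fun t y => exp (l * R.A k * t / 2) •
              v ((exp (l * R.A k * t) - 1) / (l * R.A k)) (exp (l * R.A k * t / 2) • y))
            (fun t y => exp (-(l * R.A k * t)) •
              w ((exp (l * R.A k * t) - 1) / (l * R.A k)) (exp (l * R.A k * t / 2) • y)) 0)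
            (embedXY y' + z₀ • eZ) 2) / (4 * π)) := by
  have hγ : 0 < l * R.A k := mul_pos hl (R.A_pos k)
  have hτ : (exp (l * R.A k * 0) - 1) / (l * R.A k) ≤ (exp (l * R.A k * t) - 1) / (l * R.A k) := by
    refine div_le_div_of_nonneg_right ?_ hγ.le
    exact sub_le_sub_right (exp_le_exp.2 (mul_le_mul_of_nonneg_left htt hγ.le)) 1
  have h := norm_swirl_lundgren_le_sqrt_sharp (γ := fun _ => l * R.A k)
    (a := fun t => exp (l * R.A k * t / 2)) (τ := fun t => (exp (l * R.A k * t) - 1) / (l * R.A k))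
    (d := fun t => exp (-(l * R.A k * t))) hS' zero_le_one hv hω hBS hw hmaps h0 ht hτ
    (exp_pos _).ne' hpos hB z₀ y
  simp only [mul_zero, zero_div, exp_zero, one_pow, div_one, abs_of_pos (exp_pos _)] at h
  exact h

/-! ### §2 The strain floor after the budget -/

/-- The axial component of the curl is a difference of two Jacobian entries, hence at most twice the
operator norm of the velocity gradient (MB (1.11)). [folklore] -/
private theorem curl_apply_two_le_two_mul_norm_fderiv
    (u : EuclideanSpace ℝ (Fin 3) → EuclideanSpace ℝ (Fin 3)) (x : EuclideanSpace ℝ (Fin 3)) :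
    curl u x 2 ≤ 2 * ‖fderiv ℝ u x‖ := by
  have hD : ∀ j i : Fin 3, |fderiv ℝ u x (EuclideanSpace.single j 1) i| ≤ ‖fderiv ℝ u x‖ := by
    intro j i
    calc |fderiv ℝ u x (EuclideanSpace.single j 1) i|
        = ‖fderiv ℝ u x (EuclideanSpace.single j 1) i‖ := (Real.norm_eq_abs _).symm
      _ ≤ ‖fderiv ℝ u x (EuclideanSpace.single j 1)‖ := PiLp.norm_apply_le _ i
      _ ≤ ‖fderiv ℝ u x‖ * ‖EuclideanSpace.single j (1 : ℝ)‖ := ContinuousLinearMap.le_opNorm _ _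
      _ = ‖fderiv ℝ u x‖ := by rw [EuclideanSpace.single, PiLp.norm_single, norm_one, mul_one]
  have h01 := hD 0 1
  have h10 := hD 1 0
  have e : curl u x 2 = fderiv ℝ u x (EuclideanSpace.single 0 1) 1 -
      fderiv ℝ u x (EuclideanSpace.single 1 1) 0 := by
    simp [curl]
  rw [e]
  linarith [(abs_le.1 h01).2, (abs_le.1 h10).1]

/-- **THE CHILD'S STRAIN FLOOR AFTER THE BUDGET, FOR ANY PROFILE** (`ν = 1`, host strain `λA_k`,
tolerance `ρ > 1`; setting of `_childPeak_floor_of_budget_anyProfile`: co-signed child, `Γ > 0`, core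
fatter than the tolerated one, N-2′ budget `λA_k t ≥ log((s_eff(0)λA_k − 1)/(ρ − 1))` delivered): EVERY
pointwise bound `‖∇u(t, x)‖ ≤ L` of the velocity gradient of the child's (full, strained) flow satisfies
**`Γ·λA_k/(16πρ) ≤ L`** — one half of the peak floor, since `ω_z ≤ 2‖∇u‖` pointwise. For the Burgers
vortex the swirl gradient on the axis has norm `ΓλA_k/(8π)` exactly. A FLOOR reading for
`stub_strain_floors`, whatever the profile. -/
theorem palasekTowerBreakdown_childStrain_floor_of_budget_anyProfile (R : TowerRates) (k : ℕ) {l : ℝ}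
    (hl : 0 < l) (hS' : Convex ℝ S') (hv : IsClassicalNSSolutionOn S' 1 0 v q)
    (hω : HasUniformRapidDecayOn S' (fun σ η => PlanarEigenmode.vorticity (v σ) η))
    (hBS : ∀ σ ∈ S', ∀ η, v σ η = biotSavart2D (PlanarEigenmode.vorticity (v σ)) η)
    (hw : IsSmoothSpaceTimeOn S' w)
    (hmaps : MapsTo (fun t => (exp (l * R.A k * t) - 1) / (l * R.A k)) S S') (h0 : (0 : ℝ) ∈ S)
    {t : ℝ} (ht : t ∈ S) (ht0 : 0 ≤ t) (z₀ z : ℝ)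
    (hpos : ∀ x : EuclideanSpace ℝ (Fin 3), 0 ≤ curl (velocity (fun _ => l * R.A k)
          (fun t y => exp (l * R.A k * t / 2) •
            v ((exp (l * R.A k * t) - 1) / (l * R.A k)) (exp (l * R.A k * t / 2) • y))
          (fun t y => exp (-(l * R.A k * t)) •
            w ((exp (l * R.A k * t) - 1) / (l * R.A k)) (exp (l * R.A k * t / 2) • y)) 0) x 2)
    (hΓ : 0 < ∫ y : EuclideanSpace ℝ (Fin 2),
        curl (velocity (fun _ => l * R.A k)
          (fun t y => exp (l * R.A k * t / 2) •
            v ((exp (l * R.A k * t) - 1) / (l * R.A k)) (exp (l * R.A k * t / 2) • y))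
          (fun t y => exp (-(l * R.A k * t)) •
            w ((exp (l * R.A k * t) - 1) / (l * R.A k)) (exp (l * R.A k * t / 2) • y)) 0)
          (embedXY y + z₀ • eZ) 2)
    {ρ : ℝ} (hρ : 1 < ρ)
    (hfat : ρ * (1 / (l * R.A k)) < (∫ y : EuclideanSpace ℝ (Fin 2), ‖y‖ ^ 2 *
        curl (velocity (fun _ => l * R.A k)
          (fun t y => exp (l * R.A k * t / 2) •
            v ((exp (l * R.A k * t) - 1) / (l * R.A k)) (exp (l * R.A k * t / 2) • y))
          (fun t y => exp (-(l * R.A k * t)) •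
            w ((exp (l * R.A k * t) - 1) / (l * R.A k)) (exp (l * R.A k * t / 2) • y)) 0)
          (embedXY y + z₀ • eZ) 2) /
        (4 * ∫ y : EuclideanSpace ℝ (Fin 2),
          curl (velocity (fun _ => l * R.A k)
          (fun t y => exp (l * R.A k * t / 2) •
            v ((exp (l * R.A k * t) - 1) / (l * R.A k)) (exp (l * R.A k * t / 2) • y))
          (fun t y => exp (-(l * R.A k * t)) •
            w ((exp (l * R.A k * t) - 1) / (l * R.A k)) (exp (l * R.A k * t / 2) • y)) 0)
          (embedXY y + z₀ • eZ) 2))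
    (hbud : log (((∫ y : EuclideanSpace ℝ (Fin 2), ‖y‖ ^ 2 *
        curl (velocity (fun _ => l * R.A k)
          (fun t y => exp (l * R.A k * t / 2) •
            v ((exp (l * R.A k * t) - 1) / (l * R.A k)) (exp (l * R.A k * t / 2) • y))
          (fun t y => exp (-(l * R.A k * t)) •
            w ((exp (l * R.A k * t) - 1) / (l * R.A k)) (exp (l * R.A k * t / 2) • y)) 0)
          (embedXY y + z₀ • eZ) 2) /
        (4 * ∫ y : EuclideanSpace ℝ (Fin 2),
          curl (velocity (fun _ => l * R.A k)
          (fun t y => exp (l * R.A k * t / 2) •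
            v ((exp (l * R.A k * t) - 1) / (l * R.A k)) (exp (l * R.A k * t / 2) • y))
          (fun t y => exp (-(l * R.A k * t)) •
            w ((exp (l * R.A k * t) - 1) / (l * R.A k)) (exp (l * R.A k * t / 2) • y)) 0)
          (embedXY y + z₀ • eZ) 2) * (l * R.A k) - 1) / (ρ - 1)) ≤ l * R.A k * t)
    {L : ℝ} (hL : ∀ x : EuclideanSpace ℝ (Fin 3), ‖fderiv ℝ (velocity (fun _ => l * R.A k)
          (fun t y => exp (l * R.A k * t / 2) •
            v ((exp (l * R.A k * t) - 1) / (l * R.A k)) (exp (l * R.A k * t / 2) • y))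
          (fun t y => exp (-(l * R.A k * t)) •
            w ((exp (l * R.A k * t) - 1) / (l * R.A k)) (exp (l * R.A k * t / 2) • y)) t) x‖ ≤ L) :
    (∫ y : EuclideanSpace ℝ (Fin 2),
        curl (velocity (fun _ => l * R.A k)
          (fun t y => exp (l * R.A k * t / 2) •
            v ((exp (l * R.A k * t) - 1) / (l * R.A k)) (exp (l * R.A k * t / 2) • y))
          (fun t y => exp (-(l * R.A k * t)) •
            w ((exp (l * R.A k * t) - 1) / (l * R.A k)) (exp (l * R.A k * t / 2) • y)) 0)
          (embedXY y + z₀ • eZ) 2) * (l * R.A k) / (16 * π * ρ) ≤ L := by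
  have hA : ∀ x : EuclideanSpace ℝ (Fin 3), curl (velocity (fun _ => l * R.A k)
          (fun t y => exp (l * R.A k * t / 2) •
            v ((exp (l * R.A k * t) - 1) / (l * R.A k)) (exp (l * R.A k * t / 2) • y))
          (fun t y => exp (-(l * R.A k * t)) •
            w ((exp (l * R.A k * t) - 1) / (l * R.A k)) (exp (l * R.A k * t / 2) • y)) t) x 2 ≤ 2 * L :=
    fun x => (curl_apply_two_le_two_mul_norm_fderiv _ x).trans (by linarith [hL x])
  have h := palasekTowerBreakdown_childPeak_floor_of_budget_anyProfile R k hl hS' hv hω hBS hw hmaps h0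
    ht ht0 z₀ z hpos hΓ hρ hfat hbud hA
  have hπ : 0 < π := pi_pos
  rw [div_le_iff₀ (by positivity)] at h ⊢
  linarith

/-! ### §3 The «Burgers number» thresholds of the any-profile bounds -/

/-- **LATE WINDOW, ANY PROFILE, IN BURGERS-NUMBER UNITS: `0.3556·P ≤ c₂` ⇒ NO OVERSHOOT OF `c₂Y_{k+1}`**
(`ν = 1`; setting of `_childSwirl_le_after_one_strain_time_anyProfile_sharp`, with the child's
circulation on the core-ledger scale, `Γ ≤ C·N_{k+1}^{β−2}`, and `P := C√λ·N_k^{β/2−b}`): once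
`λA_k t ≥ 1`, every point has `‖swirl(t, y)‖ ≤ c₂·Y_{k+1}` — by `S ≤ 0.3556·Γ(λA_k)^{1/2}` and the
identity `N_{k+1}^{β−2}(A_k)^{1/2} = N_k^{β/2−b}Y_{k+1}` (`_burgers_scaling`). Compare
`_burgers_noOvershoot`: the Burgers child needed only `P ≤ 4√2π·c₂`. -/
theorem palasekTowerBreakdown_anyProfile_noOvershoot_late (R : TowerRates)
    (k : ℕ) {l : ℝ} (hl : 0 < l) (hS' : Convex ℝ S') (hv : IsClassicalNSSolutionOn S' 1 0 v q)
    (hω : HasUniformRapidDecayOn S' (fun σ η => PlanarEigenmode.vorticity (v σ) η))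
    (hBS : ∀ σ ∈ S', ∀ η, v σ η = biotSavart2D (PlanarEigenmode.vorticity (v σ)) η)
    (hw : IsSmoothSpaceTimeOn S' w)
    (hmaps : MapsTo (fun t => (exp (l * R.A k * t) - 1) / (l * R.A k)) S S') (h0 : (0 : ℝ) ∈ S)
    {t : ℝ} (ht : t ∈ S) (hstrain : 1 ≤ l * R.A k * t) (z₀ : ℝ)
    (hpos : ∀ x : EuclideanSpace ℝ (Fin 3), 0 ≤ curl (velocity (fun _ => l * R.A k)
          (fun t y => exp (l * R.A k * t / 2) •
            v ((exp (l * R.A k * t) - 1) / (l * R.A k)) (exp (l * R.A k * t / 2) • y))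
          (fun t y => exp (-(l * R.A k * t)) •
            w ((exp (l * R.A k * t) - 1) / (l * R.A k)) (exp (l * R.A k * t / 2) • y)) 0) x 2)
    {C c₂ : ℝ}
    (hΓC : (∫ y' : EuclideanSpace ℝ (Fin 2), curl (velocity (fun _ => l * R.A k)
          (fun t y => exp (l * R.A k * t / 2) •
            v ((exp (l * R.A k * t) - 1) / (l * R.A k)) (exp (l * R.A k * t / 2) • y))
          (fun t y => exp (-(l * R.A k * t)) •
            w ((exp (l * R.A k * t) - 1) / (l * R.A k)) (exp (l * R.A k * t / 2) • y)) 0)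
          (embedXY y' + z₀ • eZ) 2) ≤ C * R.N (k + 1) ^ (R.β - 2))
    (hP : 0.3556 * (C * Real.sqrt l * R.N k ^ (R.β / 2 - R.b)) ≤ c₂)
    (y : EuclideanSpace ℝ (Fin 2)) :
    ‖exp (l * R.A k * t / 2) • v ((exp (l * R.A k * t) - 1) / (l * R.A k)) (exp (l * R.A k * t / 2) • y)‖ ≤
      c₂ * R.Y (k + 1) := by
  have hY : 0 < R.Y (k + 1) := Real.rpow_pos_of_pos (R.N_pos _) _
  have hAk : 0 < R.A k := R.A_pos k
  have h := (palasekTowerBreakdown_childSwirl_le_after_one_strain_time_anyProfile_sharp R k hl hS' hv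
    hω hBS hw hmaps h0 ht hstrain z₀ hpos y).2
  refine h.trans ?_
  have hsqrt : Real.sqrt (l * R.A k) = Real.sqrt l * Real.sqrt (R.A k) := Real.sqrt_mul hl.le _
  have hscale := palasekTowerBreakdown_burgers_scaling R k
  -- `0.3556 Γ √(λA_k) ≤ 0.3556 C N_{k+1}^{β−2} √λ √A_k = 0.3556 P Y_{k+1}`
  calc 0.3556 * (∫ y' : EuclideanSpace ℝ (Fin 2), curl (velocity (fun _ => l * R.A k)
          (fun t y => exp (l * R.A k * t / 2) •
            v ((exp (l * R.A k * t) - 1) / (l * R.A k)) (exp (l * R.A k * t / 2) • y))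
          (fun t y => exp (-(l * R.A k * t)) •
            w ((exp (l * R.A k * t) - 1) / (l * R.A k)) (exp (l * R.A k * t / 2) • y)) 0)
          (embedXY y' + z₀ • eZ) 2) * Real.sqrt (l * R.A k)
      ≤ 0.3556 * (C * R.N (k + 1) ^ (R.β - 2)) * Real.sqrt (l * R.A k) :=
        mul_le_mul_of_nonneg_right (mul_le_mul_of_nonneg_left hΓC (by norm_num)) (Real.sqrt_nonneg _)
    _ = 0.3556 * (C * Real.sqrt l * R.N k ^ (R.β / 2 - R.b)) * R.Y (k + 1) := by
        rw [hsqrt, show 0.3556 * (C * R.N (k + 1) ^ (R.β - 2)) * (Real.sqrt l * Real.sqrt (R.A k)) =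
          0.3556 * C * Real.sqrt l * (R.N (k + 1) ^ (R.β - 2) * Real.sqrt (R.A k)) by ring, hscale]
        ring
    _ ≤ c₂ * R.Y (k + 1) := mul_le_mul_of_nonneg_right hP hY.le

/-- **AFTER THE BUDGET, ANY PROFILE, IN BURGERS-NUMBER UNITS: `P ≥ 8πρ^{1/2}·c₁` ⇒ THE VELOCITY FLOOR
`c₁Y_{k+1}` IS MET** (`ν = 1`; setting of `_childSwirl_floor_of_budget_anyProfile`, with
`Γ ≥ C·N_{k+1}^{β−2}`): every bound `U` of the child's swirl speed has `c₁·Y_{k+1} ≤ U`, i.e.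
the swirl reaches the floor somewhere up to every tolerance — from `U ≥ (8π)⁻¹ρ^{−1/2}·Γ(λA_k)^{1/2}`
and `_burgers_scaling`. Compare `_burgers_floor`: the Burgers child needed `P ≥ (500π/79)·c₁ = 19.9·c₁`. -/
theorem palasekTowerBreakdown_anyProfile_floor_threshold (R : TowerRates) (k : ℕ) {l : ℝ}
    (hl : 0 < l) (hS' : Convex ℝ S') (hv : IsClassicalNSSolutionOn S' 1 0 v q)
    (hω : HasUniformRapidDecayOn S' (fun σ η => PlanarEigenmode.vorticity (v σ) η))
    (hBS : ∀ σ ∈ S', ∀ η, v σ η = biotSavart2D (PlanarEigenmode.vorticity (v σ)) η)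
    (hw : IsSmoothSpaceTimeOn S' w)
    (hmaps : MapsTo (fun t => (exp (l * R.A k * t) - 1) / (l * R.A k)) S S') (h0 : (0 : ℝ) ∈ S)
    {t : ℝ} (ht : t ∈ S) (ht0 : 0 ≤ t) (z₀ z : ℝ)
    (hpos : ∀ x : EuclideanSpace ℝ (Fin 3), 0 ≤ curl (velocity (fun _ => l * R.A k)
          (fun t y => exp (l * R.A k * t / 2) •
            v ((exp (l * R.A k * t) - 1) / (l * R.A k)) (exp (l * R.A k * t / 2) • y))
          (fun t y => exp (-(l * R.A k * t)) •
            w ((exp (l * R.A k * t) - 1) / (l * R.A k)) (exp (l * R.A k * t / 2) • y)) 0) x 2)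
    (hΓ : 0 < ∫ y : EuclideanSpace ℝ (Fin 2),
        curl (velocity (fun _ => l * R.A k)
          (fun t y => exp (l * R.A k * t / 2) •
            v ((exp (l * R.A k * t) - 1) / (l * R.A k)) (exp (l * R.A k * t / 2) • y))
          (fun t y => exp (-(l * R.A k * t)) •
            w ((exp (l * R.A k * t) - 1) / (l * R.A k)) (exp (l * R.A k * t / 2) • y)) 0)
          (embedXY y + z₀ • eZ) 2)
    {ρ : ℝ} (hρ : 1 < ρ)
    (hfat : ρ * (1 / (l * R.A k)) < (∫ y : EuclideanSpace ℝ (Fin 2), ‖y‖ ^ 2 *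
        curl (velocity (fun _ => l * R.A k)
          (fun t y => exp (l * R.A k * t / 2) •
            v ((exp (l * R.A k * t) - 1) / (l * R.A k)) (exp (l * R.A k * t / 2) • y))
          (fun t y => exp (-(l * R.A k * t)) •
            w ((exp (l * R.A k * t) - 1) / (l * R.A k)) (exp (l * R.A k * t / 2) • y)) 0)
          (embedXY y + z₀ • eZ) 2) /
        (4 * ∫ y : EuclideanSpace ℝ (Fin 2),
          curl (velocity (fun _ => l * R.A k)
          (fun t y => exp (l * R.A k * t / 2) •
            v ((exp (l * R.A k * t) - 1) / (l * R.A k)) (exp (l * R.A k * t / 2) • y))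
          (fun t y => exp (-(l * R.A k * t)) •
            w ((exp (l * R.A k * t) - 1) / (l * R.A k)) (exp (l * R.A k * t / 2) • y)) 0)
          (embedXY y + z₀ • eZ) 2))
    (hbud : log (((∫ y : EuclideanSpace ℝ (Fin 2), ‖y‖ ^ 2 *
        curl (velocity (fun _ => l * R.A k)
          (fun t y => exp (l * R.A k * t / 2) •
            v ((exp (l * R.A k * t) - 1) / (l * R.A k)) (exp (l * R.A k * t / 2) • y))
          (fun t y => exp (-(l * R.A k * t)) •
            w ((exp (l * R.A k * t) - 1) / (l * R.A k)) (exp (l * R.A k * t / 2) • y)) 0)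
          (embedXY y + z₀ • eZ) 2) /
        (4 * ∫ y : EuclideanSpace ℝ (Fin 2),
          curl (velocity (fun _ => l * R.A k)
          (fun t y => exp (l * R.A k * t / 2) •
            v ((exp (l * R.A k * t) - 1) / (l * R.A k)) (exp (l * R.A k * t / 2) • y))
          (fun t y => exp (-(l * R.A k * t)) •
            w ((exp (l * R.A k * t) - 1) / (l * R.A k)) (exp (l * R.A k * t / 2) • y)) 0)
          (embedXY y + z₀ • eZ) 2) * (l * R.A k) - 1) / (ρ - 1)) ≤ l * R.A k * t)
    {U : ℝ} (hU : ∀ y : EuclideanSpace ℝ (Fin 2), ‖exp (l * R.A k * t / 2) •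
        v ((exp (l * R.A k * t) - 1) / (l * R.A k)) (exp (l * R.A k * t / 2) • y)‖ ≤ U)
    {C c₁ : ℝ}
    (hCΓ : C * R.N (k + 1) ^ (R.β - 2) ≤ ∫ y' : EuclideanSpace ℝ (Fin 2), curl (velocity (fun _ => l * R.A k)
          (fun t y => exp (l * R.A k * t / 2) •
            v ((exp (l * R.A k * t) - 1) / (l * R.A k)) (exp (l * R.A k * t / 2) • y))
          (fun t y => exp (-(l * R.A k * t)) •
            w ((exp (l * R.A k * t) - 1) / (l * R.A k)) (exp (l * R.A k * t / 2) • y)) 0)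
          (embedXY y' + z₀ • eZ) 2)
    (hP : 8 * π * Real.sqrt ρ * c₁ ≤ C * Real.sqrt l * R.N k ^ (R.β / 2 - R.b)) :
    c₁ * R.Y (k + 1) ≤ U := by
  have hY : 0 < R.Y (k + 1) := Real.rpow_pos_of_pos (R.N_pos _) _
  have hπ : 0 < π := pi_pos
  have hρ0 : 0 < ρ := by linarith
  have hsρ : 0 < Real.sqrt ρ := Real.sqrt_pos.2 hρ0
  have h := palasekTowerBreakdown_childSwirl_floor_of_budget_anyProfile R k hl hS' hv hω hBS hw hmaps h0 ht
    ht0 z₀ z hpos hΓ hρ hfat hbud hU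
  refine le_trans ?_ h
  have hsqrt : Real.sqrt (l * R.A k / ρ) = Real.sqrt l * Real.sqrt (R.A k) / Real.sqrt ρ := by
    rw [Real.sqrt_div' _ hρ0.le, Real.sqrt_mul hl.le]
  have hscale := palasekTowerBreakdown_burgers_scaling R k
  -- `c₁ Y ≤ P Y/(8π√ρ) = C √λ (N_{k+1}^{β−2}√A_k)/(8π√ρ) ≤ Γ √(λA_k/ρ)/(8π)`
  have h1 : c₁ * R.Y (k + 1) ≤ C * Real.sqrt l * R.N k ^ (R.β / 2 - R.b) * R.Y (k + 1) / (8 * π * Real.sqrt ρ) := by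
    rw [le_div_iff₀ (by positivity)]
    calc c₁ * R.Y (k + 1) * (8 * π * Real.sqrt ρ) = (8 * π * Real.sqrt ρ * c₁) * R.Y (k + 1) := by ring
      _ ≤ C * Real.sqrt l * R.N k ^ (R.β / 2 - R.b) * R.Y (k + 1) :=
          mul_le_mul_of_nonneg_right hP hY.le
  have hden : 0 < 8 * π * Real.sqrt ρ := by positivity
  have hA0 : 0 ≤ Real.sqrt l * Real.sqrt (R.A k) := by positivity
  rw [hsqrt, div_mul_div_comm]
  refine h1.trans (div_le_div_of_nonneg_right ?_ hden.le)
  rw [show C * Real.sqrt l * R.N k ^ (R.β / 2 - R.b) * R.Y (k + 1) =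
      C * Real.sqrt l * (R.N k ^ (R.β / 2 - R.b) * R.Y (k + 1)) by ring, ← hscale]
  calc C * Real.sqrt l * (R.N (k + 1) ^ (R.β - 2) * Real.sqrt (R.A k))
      = (C * R.N (k + 1) ^ (R.β - 2)) * (Real.sqrt l * Real.sqrt (R.A k)) := by ring
    _ ≤ _ := mul_le_mul_of_nonneg_right hCΓ hA0

/-- **The two any-profile certificates never meet**: under the register's constants (`Schedule.Rigid`:
`c₁ = 1`, `c₂ = 5/3`) the late no-overshoot certificate of `_anyProfile_noOvershoot_late` needs
`P ≤ c₂/0.3556 < 4.69` while the floor certificate of `_anyProfile_floor_threshold` needs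
`P ≥ 8πρ^{1/2}c₁ > 25.13` (`ρ ≥ 1`): for ANY-profile bounds the two regions are disjoint by a factor
`> 5.3` — unlike the RADIAL class (`PalasekTowerRadialChildRelaxation`: certified floor-and-ceiling band
`[20.5, 26.6]`) and the Burgers child itself (`PalasekTowerBurgersNumber`: `[19.9, 29.6]`). Pure arithmetic
on the certified constants; a statement about BOUNDS, not about flows. -/
theorem palasekTowerBreakdown_anyProfile_thresholds_disjoint (R : TowerRates) (Sch : Schedule R)
    (hS : Sch.Rigid) {ρ P : ℝ} (hρ : 1 ≤ ρ) (hceil : 0.3556 * P ≤ Sch.c₂) :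
    P < 4.69 ∧ ¬ 8 * π * Real.sqrt ρ * Sch.c₁ ≤ P := by
  have hπ : 3.141592 < π := pi_gt_d6
  have hsρ : 1 ≤ Real.sqrt ρ := by
    rw [show (1 : ℝ) = Real.sqrt 1 by simp]
    exact Real.sqrt_le_sqrt hρ
  rw [hS.c₂_eq] at hceil
  have hP : P < 4.69 := by
    norm_num at hceil ⊢
    linarith
  refine ⟨hP, fun h => ?_⟩
  rw [hS.c₁_eq] at h
  have : 8 * π * Real.sqrt ρ * 1 ≥ 8 * 3.141592 * 1 * 1 := by nlinarith
  linarith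

end Summit.NavierStokesRegularity.FluidComputer.PalasekTowerClayBridge
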